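import Mathlib
import HarnessLib
import Summits.Ventures.LatticeQCDFlow.Exactness.PiGroupKicks
import Summits.Ventures.LatticeQCDFlow.Exactness.GroupMetropolisLinkErgodic
import Summits.Ventures.LatticeQCDFlow.Exactness.LeapfrogHMCDoeblin

/-!
# A Metropolis sweep over the links of a compact-group lattice has a Doeblin POWER once the kicks of one link cover

HONEST FRAMING: exact (Metropolis-corrected) sampling algorithms for lattice gauge theory;
figures of merit are autocorrelation/cost numbers at stated couplings and volumes; no
continuum-physics claim.

Venture `LatticeQCDFlow` (cell pub-lqcd), topic `Exactness`, FANOUT row 9 (eng-latcore, the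
engine's Metropolis sweeps `u1_2d.sweep_metropolis`, `updates.sweep_metropolis`,
`sun_2d.sweep_metropolis`: visit every link, `nhit` random-walk Metropolis hits each, the other
links frozen — at a FIXED small `nhit`, e.g. the `u1_2d` default `(step, nhit) = (1.0, 4)` that
`U1MetropolisSweepErgodic.lean` leaves open).  NEW WORK of the cell over the tree
(`PiGroupKicks.lean`: kicks compose by convolution, independent link kicks are a walk on the
product group with a product step law; `U1MetropolisLinkErgodic.lean` §1: a pinched weight makes
`n` hits dominate `(m/M)^n ×` `n` proposals; `RefreshScan.lean`: `siteLift`, `cycle_minorised`,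
`uniformlyErgodic_of_minorised`; `LeapfrogHMCDoeblin.lean`: `smul_pi_le_pi`;
`GroupMetropolisLinkErgodic.lean`: `gibbsProbability`; `SymmetricMetropolis.lean`:
`mulWalkMH_invariant`; `DoeblinUniqueness.lean`).  Nothing here is cited as a fact.

THE SWEEP on the configuration space `ι → G` (`ι` = links, finite; `G` a compact second-countable
group with Haar probability): `linkKick ν l` kicks link `l` by `X ∼ ν` (a `siteLift` of the one-link
walk — literally the shape of `u1LinkProposal`), `linkMetropolisHit ν w l = symMH (linkKick ν l) w`
for the JOINT weight `w` (`= e^{−S}`), `metropolisSweep ν w n L = cycle (L.map (l ↦ (hit_l)^n))`.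

* §1 **`linkKick_eq_mulWalk`** — the link kick IS the random walk on the product group with step
  law `ν ∘ (x ↦ 1[l ↦ x])⁻¹`; hence (`mulWalkMH_invariant` on the product group, whose product Haar
  measure is left invariant and whose one-link step law is inversion invariant)
  **`linkMetropolisHit_invariant`**, **`metropolisSweep_invariant`** — EVERY hit and the sweep leave
  `w · Haar^{⊗ι}` invariant, for every measurable `w > 0` and inversion-invariant `ν` (the
  `Π`-picture Metropolis exactness, any group).
* §2 **`metropolisSweep_nHit_minorised`** — if `k` kicks of ONE link cover
  (`∀ u, δ • Haar ≤ (mulWalk ν)^k u`), the weight is pinched `0 < m ≤ w ≤ M`, `n ≥ 1` hits per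
  visit and the scan `L` visits every link, then the `(k+1)`-st POWER of the sweep is Doeblin:
  `(S^{k+1})(U, ·) ≥ ((m/M)^{n|L|(k+1)} δ^{|ι|}) · Haar^{⊗ι}` from EVERY configuration `U`
  (order of the kicks forgotten on the product group: `pi_update_dirac_eq_map_update`,
  `foldr_mconv_pi_update`, `mconvPow_pi_succ`; `pi_dirac_one`).
* §3 **`metropolisSweep_uniformlyErgodic`** — so the sweep converges to `Z⁻¹ w · Haar^{⊗ι}`
  geometrically in total variation from every initial law (through its `(k+1)`-st power) and
  `Z⁻¹ w · Haar^{⊗ι}` is its ONLY invariant probability law.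

The `U(1)` sweep of `U1MetropolisSweepErgodic.lean` is `metropolisSweep (u1KickLaw s)` by `rfl`,
and the engine's `SU(2)` kick covers (`SU2MetropolisKickLaw.lean`): the instances are
`MetropolisSweepInstances.lean`.  NOT CLAIMED: any rate; `SU(N ≥ 3)`.
-/

noncomputable section

namespace Summit.Ventures.LatticeQCDFlow.Exactness

open MeasureTheory ProbabilityTheory Set Function
open Literature.MathematicalPhysics.QuantumFieldTheory (haarProbability)
open scoped ENNReal

/-! ## §1 The sweep, and its exactness on the product space -/

section Defs

variable {ι : Type*} [DecidableEq ι] {G : Type*} [Group G] [MeasurableSpace G] [MeasurableMul₂ G]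

/-- **Kick link `l` by `X ∼ ν`**, the other links untouched (the proposal of the sweep). -/
def linkKick (ν : Measure G) (l : ι) : Kernel (ι → G) (ι → G) :=
  siteLift l (Kernel.comap (mulWalk ν) (eval l) (measurable_pi_apply l))

/-- The link kick is an s-finite kernel. -/
instance isSFiniteKernel_linkKick (ν : Measure G) [SFinite ν] (l : ι) : IsSFiniteKernel (linkKick ν l) := by
  unfold linkKick siteLift; infer_instance

/-- The link kick is Markov for a probability step law. -/
instance isMarkovKernel_linkKick (ν : Measure G) [IsProbabilityMeasure ν] (l : ι) : IsMarkovKernel (linkKick ν l) := by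
  unfold linkKick; infer_instance

/-- **The link kick IS the random walk on the product group with the one-link step law
`ν ∘ (x ↦ 1[l ↦ x])⁻¹`** (`1[l ↦ X] · U = U[l ↦ X U_l]`). -/
theorem linkKick_eq_mulWalk (ν : Measure G) [SFinite ν] (l : ι) :
    linkKick ν l = mulWalk (ν.map (update (1 : ι → G) l)) := by
  refine Kernel.ext fun U => ?_
  rw [linkKick, siteLift_apply, Kernel.comap_apply, mulWalk_apply, mulWalk_apply,
    Measure.map_map (measurable_update U) (measurable_mul_const _),
    Measure.map_map (measurable_mul_const U) (measurable_update _)]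
  congr 1
  funext x
  show update U l (x * eval l U) = update (1 : ι → G) l x * U
  funext j
  by_cases h : j = l
  · subst h
    rw [update_self, Pi.mul_apply, update_self, eval]
  · rw [update_of_ne h, Pi.mul_apply, update_of_ne h, Pi.one_apply, one_mul]

/-- Metropolis kernels of equal proposal kernels are equal (the s-finiteness instance is a `Prop`). -/
theorem symMH_congr_kernel {Ω : Type*} [MeasurableSpace Ω] {P P' : Kernel Ω Ω} [IsSFiniteKernel P]
    [IsSFiniteKernel P'] (h : P = P') (p : Ω → ℝ) : symMH P p = symMH P' p := by
  subst h
  rfl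

/-- **The Metropolis hit of link `l`** for the joint weight `w`: propose the kick, accept with
`min(1, w(U')/w(U))`. -/
def linkMetropolisHit (ν : Measure G) [SFinite ν] (w : (ι → G) → ℝ) (l : ι) : Kernel (ι → G) (ι → G) :=
  symMH (linkKick ν l) w

/-- **The Metropolis sweep**: visit the links of `L` in order, `n` hits each. -/
def metropolisSweep (ν : Measure G) [SFinite ν] (w : (ι → G) → ℝ) (n : ℕ) (L : List ι) :
    Kernel (ι → G) (ι → G) :=
  cycle (L.map fun l => nHit (linkMetropolisHit ν w l) n)

/-- The sweep is a Markov kernel (probability step law, measurable weight). -/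
theorem isMarkovKernel_metropolisSweep (ν : Measure G) [IsProbabilityMeasure ν] {w : (ι → G) → ℝ}
    (hw : Measurable w) (n : ℕ) (L : List ι) : IsMarkovKernel (metropolisSweep ν w n L) := by
  haveI : Fact (Measurable w) := ⟨hw⟩
  refine isMarkovKernel_cycle fun κ hκ => ?_
  obtain ⟨l, -, rfl⟩ := List.mem_map.1 hκ
  haveI : IsMarkovKernel (linkMetropolisHit ν w l) := by unfold linkMetropolisHit; infer_instance
  exact isMarkovKernel_nHit _ n

omit [MeasurableMul₂ G] in
/-- The one-link step law on the product group is inversion invariant when `ν` is. -/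
theorem isInvInvariant_map_update (ν : Measure G) [ν.IsInvInvariant] [MeasurableInv G] (l : ι) :
    (ν.map (update (1 : ι → G) l)).IsInvInvariant := by
  refine ⟨?_⟩
  have hcomp : (Inv.inv ∘ update (1 : ι → G) l) = update (1 : ι → G) l ∘ Inv.inv := by
    funext x
    rw [comp_apply, comp_apply, ← update_inv, inv_one]
  rw [Measure.inv, Measure.map_map measurable_inv (measurable_update _), hcomp,
    ← Measure.map_map (measurable_update _) measurable_inv, Measure.map_inv_eq_self]

variable [Fintype ι] [MeasurableInv G] {μ : Measure G} [IsProbabilityMeasure μ] [μ.IsMulLeftInvariant]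

/-- **EVERY HIT IS EXACT ON THE PRODUCT SPACE**: for a left-invariant probability `μ` on `G`, an
inversion-invariant probability step law `ν` and every measurable `w > 0`, the Metropolis hit of
link `l` leaves `w · μ^{⊗ι}` invariant (`mulWalkMH_invariant` on the product group). -/
theorem linkMetropolisHit_invariant (ν : Measure G) [IsProbabilityMeasure ν] [ν.IsInvInvariant]
    {w : (ι → G) → ℝ} (hw : Measurable w) (hw0 : ∀ U, 0 < w U) (l : ι) :
    Kernel.Invariant (linkMetropolisHit ν w l)
      ((Measure.pi fun _ : ι => μ).withDensity fun U => ENNReal.ofReal (w U)) := by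
  haveI : IsProbabilityMeasure (ν.map (update (1 : ι → G) l)) :=
    Measure.isProbabilityMeasure_map (measurable_update _).aemeasurable
  haveI := isInvInvariant_map_update ν l
  rw [linkMetropolisHit, symMH_congr_kernel (linkKick_eq_mulWalk ν l)]
  exact mulWalkMH_invariant (μ := Measure.pi fun _ : ι => μ) hw hw0

/-- **THE SWEEP IS EXACT**: `w · μ^{⊗ι}` is invariant under the Metropolis sweep, for every scan,
every `n`, every measurable `w > 0`. -/
theorem metropolisSweep_invariant (ν : Measure G) [IsProbabilityMeasure ν] [ν.IsInvInvariant]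
    {w : (ι → G) → ℝ} (hw : Measurable w) (hw0 : ∀ U, 0 < w U) (n : ℕ) (L : List ι) :
    Kernel.Invariant (metropolisSweep ν w n L)
      ((Measure.pi fun _ : ι => μ).withDensity fun U => ENNReal.ofReal (w U)) := by
  refine invariant_cycle fun κ hκ => ?_
  obtain ⟨l, -, rfl⟩ := List.mem_map.1 hκ
  exact invariant_nHit (linkMetropolisHit_invariant ν hw hw0 l) n

end Defs

/-! ## §2 A power of the sweep is Doeblin -/

section Doeblin

variable {ι : Type*} [Fintype ι] [DecidableEq ι] {G : Type*} [TopologicalSpace G] [Group G]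
  [IsTopologicalGroup G] [CompactSpace G] [MeasurableSpace G] [BorelSpace G] [SecondCountableTopology G]
variable {ν : Measure G} [IsProbabilityMeasure ν] {w : (ι → G) → ℝ} {m M : ℝ}

omit [DecidableEq ι] [TopologicalSpace G] [IsTopologicalGroup G] [CompactSpace G] [BorelSpace G]
  [SecondCountableTopology G] [IsProbabilityMeasure ν] in
/-- `⊗_j δ₁ = δ₁` on the product group. -/
theorem pi_dirac_one : (Measure.pi fun _ : ι => Measure.dirac (1 : G)) = Measure.dirac 1 := by
  refine Measure.pi_eq fun s hs => ?_
  rw [Measure.dirac_apply' _ (MeasurableSet.univ_pi hs)]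
  simp only [Measure.dirac_apply' _ (hs _)]
  by_cases h : (1 : ι → G) ∈ Set.pi univ s
  · rw [indicator_of_mem h, Pi.one_apply, Finset.prod_eq_one]
    intro j _
    have hj : (1 : G) ∈ s j := (mem_univ_pi.1 h) j
    rw [indicator_of_mem hj, Pi.one_apply]
  · rw [indicator_of_notMem h]
    obtain ⟨j, hj⟩ := not_forall.1 (mt mem_univ_pi.2 h)
    have hj' : (1 : G) ∉ s j := hj
    exact (Finset.prod_eq_zero (Finset.mem_univ j) (by rw [indicator_of_notMem hj'])).symm

omit [Fintype ι] [CompactSpace G] in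
/-- ONE VISIT dominates `(m/M)^n ×` the walk with the `n`-th power of the one-link law. -/
theorem linkVisit_minorised (hw : Measurable w) (hm : 0 < m) (hwm : ∀ U, m ≤ w U) (hwM : ∀ U, w U ≤ M)
    (n : ℕ) (l : ι) (U : ι → G) :
    ENNReal.ofReal (m / M) ^ n • mulWalk (mconvPow (ν.map (update (1 : ι → G) l)) n) U ≤
      nHit (linkMetropolisHit ν w l) n U := by
  haveI : SFinite (ν.map (update (1 : ι → G) l)) := inferInstance
  rw [← nHit_mulWalk, ← linkKick_eq_mulWalk]
  exact smul_nHit_le_nHit_symMH hw hm hwm hwM n U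

omit [Fintype ι] [CompactSpace G] in
/-- THE SWEEP dominates `((m/M)^n)^{|L|} ×` the walk with the folded one-link laws. -/
theorem metropolisSweep_minorised_walk (hw : Measurable w) (hm : 0 < m) (hwm : ∀ U, m ≤ w U)
    (hwM : ∀ U, w U ≤ M) (n : ℕ) (L : List ι) (U : ι → G) :
    (ENNReal.ofReal (m / M) ^ n) ^ L.length •
        mulWalk (L.foldr (fun l acc => mconvPow (ν.map (update (1 : ι → G) l)) n ∗ₘ acc) (Measure.dirac 1)) U ≤
      metropolisSweep ν w n L U := by
  have hF : List.Forall₂ (fun κ Φ => ∀ a : ι → G, ENNReal.ofReal (m / M) ^ n • Φ a ≤ κ a)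
      (L.map fun l => nHit (linkMetropolisHit ν w l) n)
      (L.map fun l => mulWalk ((fun l' => mconvPow (ν.map (update (1 : ι → G) l')) n) l)) := by
    rw [List.forall₂_map_left_iff, List.forall₂_map_right_iff, List.forall₂_same]
    intro l _ a
    exact linkVisit_minorised hw hm hwm hwM n l a
  have h := cycle_minorised hF U
  rw [List.length_map, cycle_map_mulWalk (fun l' => mconvPow (ν.map (update (1 : ι → G) l')) n) L] at h
  exact h

omit [CompactSpace G] in
/-- **The folded one-link laws are the product law of per-link convolution powers**:
`foldr_l (δ₁,…,ν^{∗n},…,δ₁) ∗ · = ⊗_j ν^{∗(n · count j L)}` (order forgotten). -/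
theorem foldr_linkLaw_eq_pi (n : ℕ) (L : List ι) :
    L.foldr (fun l acc => mconvPow (ν.map (update (1 : ι → G) l)) n ∗ₘ acc) (Measure.dirac 1) =
      Measure.pi fun j => mconvPow ν (n * L.count j) := by
  have he : ∀ l : ι, mconvPow (ν.map (update (1 : ι → G) l)) n =
      Measure.pi (update (fun _ : ι => Measure.dirac (1 : G)) l (mconvPow ν n)) := by
    intro l
    rw [← pi_update_dirac_eq_map_update]
    cases n with
    | zero =>
        rw [mconvPow_zero, mconvPow_zero]
        have hupd : update (fun _ : ι => Measure.dirac (1 : G)) l (Measure.dirac 1) =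
            fun _ : ι => Measure.dirac (1 : G) := update_eq_self l _
        rw [hupd, pi_dirac_one]
    | succ n =>
        rw [mconvPow_pi_succ]
        congr 1
        funext j
        exact mconvPow_update_dirac ν l j (n + 1)
  simp_rw [he]
  rw [← pi_dirac_one, foldr_mconv_pi_update (mconvPow ν n) L]
  congr 1
  funext j
  rw [mconvPow_mul]

/-- Each coordinate of the folded law, raised to the `(k+1)`-st power, dominates `δ ·` Haar once
`k` kicks of one link cover, `n ≥ 1` and the link is visited. -/
theorem smul_haar_le_mconvPow {k : ℕ} {δ : ℝ≥0∞}
    (hcov : ∀ u : G, δ • haarProbability G ≤ nHit (mulWalk ν) k u) {e : ℕ} (he : k ≤ e) :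
    δ • haarProbability G ≤ mconvPow ν e := by
  rw [mconvPow_eq_nHit_one]
  exact nHit_mulWalk_minorised_of_le ν hcov he 1

/-- **A POWER OF THE SWEEP IS DOEBLIN.**  If `k` kicks of one link cover (`(mulWalk ν)^k(u,·) ≥ δ·Haar`
from every `u`), the measurable joint weight is pinched `0 < m ≤ w ≤ M`, `n ≥ 1` and the scan `L`
visits every link, then from EVERY configuration `U`
`(S^{k+1})(U, ·) ≥ (((m/M)^n)^{|L|})^{k+1} δ^{|ι|} · Haar^{⊗ι}`, `S = metropolisSweep ν w n L`. -/
theorem metropolisSweep_nHit_minorised {k : ℕ} {δ : ℝ≥0∞}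
    (hcov : ∀ u : G, δ • haarProbability G ≤ nHit (mulWalk ν) k u) (hw : Measurable w) (hm : 0 < m)
    (hwm : ∀ U, m ≤ w U) (hwM : ∀ U, w U ≤ M) {n : ℕ} (hn : 1 ≤ n) {L : List ι} (hL : ∀ j, j ∈ L)
    (U : ι → G) :
    (((ENNReal.ofReal (m / M) ^ n) ^ L.length) ^ (k + 1) * δ ^ Fintype.card ι) •
        Measure.pi (fun _ : ι => haarProbability G) ≤ nHit (metropolisSweep ν w n L) (k + 1) U := by
  haveI : ∀ j, IsProbabilityMeasure (mconvPow ν (n * L.count j)) := fun j => isProbabilityMeasure_mconvPow _ _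
  haveI := sFinite_foldr_mconv (fun l : ι => mconvPow (ν.map (update (1 : ι → G) l)) n) L
  -- the `(k+1)`-st power of the sweep dominates the walk with the `(k+1)`-st power of the product law
  have hwalk := smul_nHit_le_nHit (metropolisSweep_minorised_walk (ν := ν) hw hm hwm hwM n L) (k + 1) U
  rw [nHit_mulWalk, foldr_linkLaw_eq_pi, mconvPow_pi_succ] at hwalk
  -- each coordinate dominates `δ ·` Haar
  have hcoord : ∀ j : ι, δ • haarProbability G ≤ mconvPow (mconvPow ν (n * L.count j)) (k + 1) := by
    intro j
    rw [← mconvPow_mul]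
    refine smul_haar_le_mconvPow hcov ?_
    have hc : 1 ≤ L.count j := List.count_pos_iff.2 (hL j)
    calc k ≤ k + 1 := Nat.le_succ k
      _ = 1 * 1 * (k + 1) := by ring
      _ ≤ n * L.count j * (k + 1) := Nat.mul_le_mul_right _ (Nat.mul_le_mul hn hc)
  have hpi : δ ^ Fintype.card ι • Measure.pi (fun _ : ι => haarProbability G) ≤
      Measure.pi fun j => mconvPow (mconvPow ν (n * L.count j)) (k + 1) := by
    have h := smul_pi_le_pi (c := fun _ : ι => δ) hcoord
    rwa [Finset.prod_const, Finset.card_univ] at h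
  -- translate by `U` (right invariance of product Haar) and assemble
  have hmul : δ ^ Fintype.card ι • Measure.pi (fun _ : ι => haarProbability G) ≤
      mulWalk (Measure.pi fun j => mconvPow (mconvPow ν (n * L.count j)) (k + 1)) U := by
    rw [mulWalk_apply]
    have h := Measure.map_mono hpi (measurable_mul_const U)
    rwa [Measure.map_smul, map_mul_right_eq_self] at h
  calc (((ENNReal.ofReal (m / M) ^ n) ^ L.length) ^ (k + 1) * δ ^ Fintype.card ι) •
        Measure.pi (fun _ : ι => haarProbability G)
      = ((ENNReal.ofReal (m / M) ^ n) ^ L.length) ^ (k + 1) •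
          (δ ^ Fintype.card ι • Measure.pi (fun _ : ι => haarProbability G)) := by rw [mul_smul]
    _ ≤ ((ENNReal.ofReal (m / M) ^ n) ^ L.length) ^ (k + 1) •
          mulWalk (Measure.pi fun j => mconvPow (mconvPow ν (n * L.count j)) (k + 1)) U :=
        measure_smul_le_smul_of_le hmul _
    _ ≤ nHit (metropolisSweep ν w n L) (k + 1) U := hwalk

omit [DecidableEq ι] [TopologicalSpace G] [IsTopologicalGroup G] [CompactSpace G] [MeasurableSpace G]
  [BorelSpace G] [SecondCountableTopology G] in
/-- The Doeblin constant is positive. -/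
theorem metropolisSweep_const_pos {k : ℕ} {δ : ℝ≥0∞} (hδ : 0 < δ) (hm : 0 < m) (hwm : ∀ U, m ≤ w U)
    (hwM : ∀ U, w U ≤ M) (n : ℕ) (L : List ι) :
    0 < ((ENNReal.ofReal (m / M) ^ n) ^ L.length) ^ (k + 1) * δ ^ Fintype.card ι := by
  have hM : 0 < M := hm.trans_le ((hwm fun _ => 1).trans (hwM _))
  have hmM : ENNReal.ofReal (m / M) ≠ 0 := by
    rw [Ne, ENNReal.ofReal_eq_zero, not_le]; exact div_pos hm hM
  exact ENNReal.mul_pos (pow_ne_zero _ (pow_ne_zero _ (pow_ne_zero _ hmM))) (pow_ne_zero _ hδ.ne')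

/-! ## §3 Uniform ergodicity of the sweep and uniqueness of its invariant law -/

/-- **THE METROPOLIS SWEEP IS UNIFORMLY ERGODIC ONCE THE KICKS OF ONE LINK COVER.**  For an
inversion-invariant probability step law `ν` with `(mulWalk ν)^k(u,·) ≥ δ · Haar` from every `u`
(`δ > 0`), a measurable joint weight pinched `0 < m ≤ w ≤ M`, `n ≥ 1` hits per visit and a scan `L`
through every link: with `S = metropolisSweep ν w n L` and `π = Z⁻¹ w · Haar^{⊗ι}` there is
`ε ∈ (0, 1]` such that `|μ₀ (S^{k+1})ᵗ(A) − π(A)| ≤ (1 − ε)ᵗ` for every initial law `μ₀`, every `t`,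
every `A`; and `π` is the ONLY probability law invariant under `S`. -/
theorem metropolisSweep_uniformlyErgodic [ν.IsInvInvariant] {k : ℕ} {δ : ℝ≥0∞}
    (hcov : ∀ u : G, δ • haarProbability G ≤ nHit (mulWalk ν) k u) (hδ : 0 < δ) (hw : Measurable w)
    (hm : 0 < m) (hwm : ∀ U, m ≤ w U) (hwM : ∀ U, w U ≤ M) {n : ℕ} (hn : 1 ≤ n) {L : List ι}
    (hL : ∀ j, j ∈ L) :
    ∃ ε : ℝ, 0 < ε ∧ ε ≤ 1 ∧
      (∀ (μ₀ : Measure (ι → G)) [IsProbabilityMeasure μ₀] (t : ℕ) (A : Set (ι → G)),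
        |((fun m' : Measure (ι → G) => m'.bind (nHit (metropolisSweep ν w n L) (k + 1)))^[t] μ₀).real A
            - (gibbsProbability (Measure.pi fun _ : ι => haarProbability G) w).real A| ≤ (1 - ε) ^ t) ∧
      ∀ (π' : Measure (ι → G)) [IsProbabilityMeasure π'], Kernel.Invariant (metropolisSweep ν w n L) π' →
        π' = gibbsProbability (Measure.pi fun _ : ι => haarProbability G) w := by
  haveI := isMarkovKernel_metropolisSweep ν hw n L
  haveI : IsMarkovKernel (nHit (metropolisSweep ν w n L) (k + 1)) := isMarkovKernel_nHit _ _
  haveI := isProbabilityMeasure_gibbsProbability (μ := Measure.pi fun _ : ι => haarProbability G) hm hwm hwM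
  have hw0 : ∀ U, 0 < w U := fun U => hm.trans_le (hwm U)
  have hmin := metropolisSweep_nHit_minorised hcov hw hm hwm hwM hn hL
  set ε : ℝ≥0∞ := ((ENNReal.ofReal (m / M) ^ n) ^ L.length) ^ (k + 1) * δ ^ Fintype.card ι
  have hε0 : 0 < ε := metropolisSweep_const_pos hδ hm hwm hwM n L
  have hε1 : ε ≤ 1 := by
    have h := Measure.le_iff'.1 (hmin 1) univ
    rwa [Measure.smul_apply, smul_eq_mul, measure_univ, measure_univ, mul_one] at h
  have hεtop : ε ≠ ⊤ := ne_top_of_le_ne_top ENNReal.one_ne_top hε1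
  have hinv : Kernel.Invariant (nHit (metropolisSweep ν w n L) (k + 1))
      (gibbsProbability (Measure.pi fun _ : ι => haarProbability G) w) :=
    invariant_nHit (invariant_gibbsProbability (metropolisSweep_invariant ν hw hw0 n L)) (k + 1)
  refine ⟨ε.toReal, ENNReal.toReal_pos hε0.ne' hεtop,
    ENNReal.toReal_le_of_le_ofReal zero_le_one (by rwa [ENNReal.ofReal_one]), fun μ₀ _ t A => ?_,
    fun π' _ hπ' => ?_⟩
  · exact uniformlyErgodic_of_minorised hmin hinv μ₀ t A
  · exact invariant_unique_of_minorised hmin hε0 hinv (invariant_nHit hπ' (k + 1))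

end Doeblin

end Summit.Ventures.LatticeQCDFlow.Exactness
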